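import Summits.CriticalPhenomena.PercolationContinuityZ3.Theorems.PercNearOneGluingNoHeavyQuantFarSunAtoms
import HarnessLib

/-!
# FAR beyond trees: the SUN-LAW DICTIONARY II — the law of the reached-tip set of the sun graph `C_{K+1}` is `sunLaw`, its marginals are
# `sunMarg`; hence `SunFAR K j` gives FAR at layer `j` on the sun graph (all `K ≥ 2`)

builds on p205010 (kernel theorem, internal audit signed; external expert review pending)

Support file (`--supports stmt-CriticalPhenomena-4575`), seat `prim-cert-1` (gen 20); QUANT lane rung R8, front "FAR beyond trees" (lead g22; the
"two-chain functional + bridge" asked for by prim-quant-p1 g16, `FOR-LEAD-TWOCHAIN-A.md` §10 item 3).  Vocabulary `…QuantFarSunLawDefs`, atoms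
`…QuantFarSunAtoms`.  For a weight function `q` on the pairs of `Fin (2K+1)` vanishing off the sun graph `sunEs K` (`g = sunG K q`, `h = sunH K q`):

* `real_sun_reached_eq` — **THE LAW OF THE REACHED-TIP SET**: for every predicate `Φ` of the set of reached hair indices,
  `P_q(Φ{k < K : o ↔ t_k}) = sunLaw K g h Φ = Σ_{Q ⊆ [0,K)} Σ_{(l,l') ∈ arcIx K} hairW Q · arcW l l' · 𝟙[Φ(Q ∩ cov l l')]`;
  `real_sun_relayCount_le_eq` — in particular `P_q(#{k < K : o ↔ t_k} ≤ j) = sunLaw K g h (#· ≤ j)` (the relay count at every layer);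
* `real_hair_and_cyc_open`, `real_sun_openConn_tip_eq` — **MARGINALS**: `P_q(o ↔ t_k) = sunMarg K g h k = h k · (α_{k+1} + β_{k+1} − α_{K+1})`;
  `sum_real_sun_openConn_tip_eq` — `Σ_{k<K} P_q(o ↔ t_k) = Σ_{k<K} sunMarg K g h k`;
* `farp_sun_of_sunFAR` — **THE BRIDGE**: `SunFAR K j → ∀ q vanishing off sunEs K, TwoCopy.FARp q (tips) (c_0) j` — the hypothesis of the segment
  reduction `HairyCycle.farp_of_sun`; the hairy-cycle corollaries (`Quant.FarRelayRow`'s body on every hairy cycle with `K` hairs) are drawn in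
  `…QuantFarSunRow`.
No sorries; standard axioms.  [cite: Grimmett1999, §1.3 p. 10; §2.2] (product measure); [cite: KozmaNitzan2024, Conjecture 3 (p. 15)] (context); [this work].
-/

noncomputable section

namespace Summit.CriticalPhenomena.PercolationContinuityZ3.Theorems.HairyCycle

open Finset MeasureTheory
open Literature.Probability.Percolation Literature.Probability.LatticeModels
open Summit.CriticalPhenomena.PercolationContinuityZ3.Theorems.AdditiveGluing.Negative.Cert
open Summit.CriticalPhenomena.PercolationContinuityZ3.Theorems.TwoCopy
open scoped Classical

variable {K : ℕ}

/-! ## Marginals -/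

/-- **A hair and a set of cycle edges are open with probability `h k · ∏ g m`** (cylinder). [this work] -/
theorem real_hair_and_cyc_open (hK : 2 ≤ K) (q : Sym2 (Fin (2 * K + 1)) → unitInterval) {k : ℕ} (hk : k < K)
    {F : Finset ℕ} (hF : F ⊆ range (K + 1)) :
    (prodBernoulli q).real {ω | hairE (sunCyc K) sunBase (sunTip K) k ∈ ω ∧ ∀ m ∈ F, cycE (K + 1) (sunCyc K) m ∈ ω} =
      sunH K q k * ∏ m ∈ F, sunG K q m := by
  have HS := isHairyCycle_sun hK
  set hE : ℕ → Sym2 (Fin (2 * K + 1)) := hairE (sunCyc K) sunBase (sunTip K) with hhE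
  set cE : ℕ → Sym2 (Fin (2 * K + 1)) := cycE (K + 1) (sunCyc K) with hcE
  have hset : {ω : Set (Sym2 (Fin (2 * K + 1))) | hE k ∈ ω ∧ ∀ m ∈ F, cE m ∈ ω} =
      {ω | ((insert (hE k) (F.image cE) : Finset _) : Set (Sym2 (Fin (2 * K + 1)))) ⊆ ω} := by
    ext ω
    simp only [Set.mem_setOf_eq, Finset.coe_insert, Finset.coe_image, Set.insert_subset_iff, Set.image_subset_iff]
    constructor
    · rintro ⟨h1, h2⟩; exact ⟨h1, fun m hm => h2 m hm⟩
    · rintro ⟨h1, h2⟩; exact ⟨h1, fun m hm => h2 hm⟩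
  have hnot : hE k ∉ F.image cE := by
    rw [Finset.mem_image]
    rintro ⟨m, hm, hmk⟩
    exact hairE_ne_cycE HS hk (Finset.mem_range.1 (hF hm)) hmk.symm
  have hinj : Set.InjOn cE F := fun m hm m' hm' h =>
    cycE_inj HS (Finset.mem_range.1 (hF hm)) (Finset.mem_range.1 (hF hm')) h
  rw [hset, prodBernoulli_real_subset, Finset.prod_insert hnot, Finset.prod_image hinj]
  rfl

/-- **MARGINALS of the sun graph**: `P_q(o ↔ t_k) = h k · (α_{k+1} + β_{k+1} − c)` with `c = α_{K+1}` (both arcs open). [this work] -/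
theorem real_sun_openConn_tip_eq (hK : 2 ≤ K) (q : Sym2 (Fin (2 * K + 1)) → unitInterval) (hq : VanishesOff q (sunEs K))
    {k : ℕ} (hk : k < K) :
    (prodBernoulli q).real (openConn (sunCyc K 0) (sunTip K k)) =
      sunMarg K (sunG K q) (sunH K q) k := by
  have HS := isHairyCycle_sun hK
  set μ := prodBernoulli q with hμ
  set hE : ℕ → Sym2 (Fin (2 * K + 1)) := hairE (sunCyc K) sunBase (sunTip K) with hhE
  set cE : ℕ → Sym2 (Fin (2 * K + 1)) := cycE (K + 1) (sunCyc K) with hcE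
  set A : Set (Set (Sym2 (Fin (2 * K + 1)))) := {ω | hE k ∈ ω ∧ ∀ m ∈ range (k + 1), cE m ∈ ω} with hA
  set B : Set (Set (Sym2 (Fin (2 * K + 1)))) := {ω | hE k ∈ ω ∧ ∀ m ∈ Ico (k + 1) (K + 1), cE m ∈ ω} with hB
  have hAB : A ∩ B = {ω | hE k ∈ ω ∧ ∀ m ∈ range (K + 1), cE m ∈ ω} := by
    ext ω
    simp only [hA, hB, Set.mem_inter_iff, Set.mem_setOf_eq, Finset.mem_range, Finset.mem_Ico]
    constructor
    · rintro ⟨⟨h1, h2⟩, -, h3⟩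
      refine ⟨h1, fun m hm => ?_⟩
      by_cases hmk : m < k + 1
      · exact h2 m hmk
      · exact h3 m ⟨by omega, hm⟩
    · rintro ⟨h1, h2⟩
      exact ⟨⟨h1, fun m hm => h2 m (by omega)⟩, h1, fun m hm => h2 m hm.2⟩
  -- almost surely, `o ↔ t_k` iff the hair is open and one of the two arcs is open
  have hev : μ.real (openConn (sunCyc K 0) (sunTip K k)) = μ.real (A ∪ B) := by
    refine real_congr_of_good q fun ω hω => ?_
    rw [mem_openConn_tip_iff (K + 1) (sunCyc K) K sunBase (sunTip K) HS.hL HS.hcyc HS.hbase HS.htip HS.hoff ω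
      (carried_of_good q hq hω) hk]
    unfold RT RC CW CCW sunBase
    simp only [hA, hB, Set.mem_union, Set.mem_setOf_eq, Finset.mem_range, Finset.mem_Ico]
    constructor
    · rintro ⟨hRC | hRC, hh⟩
      · exact Or.inl ⟨hh, hRC⟩
      · exact Or.inr ⟨hh, fun m hm => hRC m hm.1 hm.2⟩
    · rintro (⟨hh, h⟩ | ⟨hh, h⟩)
      · exact ⟨Or.inl h, hh⟩
      · exact ⟨Or.inr fun m h1 h2 => h m ⟨h1, h2⟩, hh⟩
  have hunion : μ.real (A ∪ B) = μ.real A + μ.real B - μ.real (A ∩ B) := by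
    have := measureReal_union_add_inter (μ := μ) (s := A) (t := B) MeasurableSet.of_discrete
    linarith
  have hkr : range (k + 1) ⊆ range (K + 1) := Finset.range_subset_range.2 (by omega)
  have hico : Ico (k + 1) (K + 1) ⊆ range (K + 1) := fun m hm => by
    rw [Finset.mem_Ico] at hm; rw [Finset.mem_range]; exact hm.2
  rw [hev, hunion, hAB, hA, hB, real_hair_and_cyc_open hK q hk hkr, real_hair_and_cyc_open hK q hk hico,
    real_hair_and_cyc_open hK q hk (subset_refl _)]
  unfold sunMarg arcA arcB
  ring

/-! ## The law of the reached-tip set -/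

/-- **THE LAW OF THE REACHED-TIP SET OF THE SUN GRAPH (all `K ≥ 2`).**  For a weight function `q` vanishing off the sun graph `sunEs K`
and every predicate `Φ` of the set of reached hair indices:
`P_q(Φ{k < K : o ↔ t_k}) = Σ_{Q ⊆ [0,K)} Σ_{(l,l') ∈ arcIx K} hairW Q · arcW l l' · 𝟙[Φ(Q ∩ cov l l')]`. [this work] -/
theorem real_sun_reached_eq (hK : 2 ≤ K) (q : Sym2 (Fin (2 * K + 1)) → unitInterval) (hq : VanishesOff q (sunEs K))
    (Φ : Finset ℕ → Prop) :
    (prodBernoulli q).real {ω | Φ ((range K).filter fun k => ω ∈ openConn (sunCyc K 0) (sunTip K k))} =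
      sunLaw K (sunG K q) (sunH K q) Φ := by
  set μ := prodBernoulli q with hμ
  set E : Set (Set (Sym2 (Fin (2 * K + 1)))) := {ω | Φ ((range K).filter fun k => ω ∈ openConn (sunCyc K 0) (sunTip K k))}
    with hEdef
  -- partition by atoms
  unfold sunLaw
  rw [real_eq_sum_inter_atom q E, Finset.sum_product]
  refine Finset.sum_congr rfl fun Q hQ => Finset.sum_congr rfl fun p hp => ?_
  rw [Finset.mem_powerset] at hQ
  have hp' : (p.1, p.2) ∈ arcIx K := hp
  -- on the atom the reached set is `Q ∩ cov`
  by_cases hΦ : Φ (Q ∩ cov K p.1 p.2)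
  · rw [if_pos hΦ, mul_one, ← real_atom_eq hK q hQ]
    refine real_congr_of_good q fun ω hω => ⟨fun h => h.2, fun h => ⟨?_, h⟩⟩
    show Φ _
    rw [reached_eq_of_mem_atom hK hp' (carried_of_good q hq hω) h]
    exact hΦ
  · rw [if_neg hΦ, mul_zero]
    rw [real_congr_of_good q (Y := ∅) fun ω hω => ⟨fun h => hΦ ?_, fun h => absurd h (Set.notMem_empty ω)⟩,
      measureReal_empty]
    have h1 : Φ _ := h.1
    rwa [reached_eq_of_mem_atom hK hp' (carried_of_good q hq hω) h.2] at h1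


/-- **The law of the relay count at every layer**: `P_q(#{k < K : o ↔ t_k} ≤ j) = sunLaw K g h (#· ≤ j)` (the event of `TwoCopy.FARp` on the
sun graph, relays = the tips). [this work] -/
theorem real_sun_relayCount_le_eq (hK : 2 ≤ K) (q : Sym2 (Fin (2 * K + 1)) → unitInterval) (hq : VanishesOff q (sunEs K)) (j : ℕ) :
    (prodBernoulli q).real {ω : BondConfig (Fin (2 * K + 1)) |
      (((range K).image (sunTip K)).filter fun v => ω ∈ openConn (sunCyc K 0) v).card ≤ j} =
      sunLaw K (sunG K q) (sunH K q) (fun R => R.card ≤ j) := by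
  rw [← real_sun_reached_eq hK q hq (fun R => R.card ≤ j)]
  congr 1
  ext ω
  simp only [Set.mem_setOf_eq]
  rw [Finset.filter_image, Finset.card_image_of_injOn]
  exact fun k hk k' hk' h => sunTip_inj K k k' (Finset.mem_range.1 (Finset.mem_filter.1 hk).1)
    (Finset.mem_range.1 (Finset.mem_filter.1 hk').1) h

/-- **Sum of the marginals**: `Σ_{tips} P_q(o ↔ t_k) = Σ_{k<K} sunMarg K g h k`. [this work] -/
theorem sum_real_sun_openConn_tip_eq (hK : 2 ≤ K) (q : Sym2 (Fin (2 * K + 1)) → unitInterval) (hq : VanishesOff q (sunEs K)) :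
    ∑ v ∈ (range K).image (sunTip K), (prodBernoulli q).real (openConn (sunCyc K 0) v) =
      ∑ k ∈ range K, sunMarg K (sunG K q) (sunH K q) k := by
  rw [Finset.sum_image fun k hk k' hk' h => sunTip_inj K k k' (Finset.mem_range.1 hk) (Finset.mem_range.1 hk') h]
  exact Finset.sum_congr rfl fun k hk => real_sun_openConn_tip_eq hK q hq (Finset.mem_range.1 hk)

/-- Cycle-edge weights lie in `[0, 1]`. [this work] -/
theorem sunG_mem (q : Sym2 (Fin (2 * K + 1)) → unitInterval) (m : ℕ) : 0 ≤ sunG K q m ∧ sunG K q m ≤ 1 :=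
  ⟨(q _).2.1, (q _).2.2⟩

/-- Hair weights lie in `[0, 1]`. [this work] -/
theorem sunH_mem (q : Sym2 (Fin (2 * K + 1)) → unitInterval) (k : ℕ) : 0 ≤ sunH K q k ∧ sunH K q k ≤ 1 :=
  ⟨(q _).2.1, (q _).2.2⟩

/-! ## The bridge: `SunFAR K j` is FAR at layer `j` on the sun graph for every weight function -/

/-- **THE BRIDGE (law level ⟹ measure level).**  `SunFAR K j` gives the FAR instance `TwoCopy.FARp q (tips) c_0 j` for every weight function `q`
vanishing off the sun graph — the hypothesis of the segment reduction `HairyCycle.farp_of_sun` / `farp_of_sunD`. [this work] -/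
theorem farp_sun_of_sunFAR (hK : 2 ≤ K) {j : ℕ} (hS : SunFAR K j) (q : Sym2 (Fin (2 * K + 1)) → unitInterval)
    (hq : VanishesOff q (sunEs K)) : FARp q ((range K).image (sunTip K)) (sunCyc K 0) j := by
  intro hEN t hcut
  rw [sum_real_sun_openConn_tip_eq hK q hq] at hEN
  rw [real_sun_relayCount_le_eq hK q hq j]
  refine hS _ _ (fun m _ => sunG_mem q m) (fun k _ => sunH_mem q k) hEN t fun k hk => ?_
  have h := hcut (sunTip K k) (Finset.mem_image_of_mem _ (Finset.mem_range.2 hk))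
  rwa [probReal_compl_eq_one_sub MeasurableSet.of_discrete, real_sun_openConn_tip_eq hK q hq hk] at h

/-- **Realisation**: every law-level datum (`g m ∈ [0,1]` for `m ≤ K`, `h k ∈ [0,1]` for `k < K`) is read off SOME weight function vanishing
off the sun graph. [this work] -/
theorem exists_sun_weight (hK : 2 ≤ K) (g h : ℕ → ℝ) (hg : ∀ m, m ≤ K → 0 ≤ g m ∧ g m ≤ 1)
    (hh : ∀ k, k < K → 0 ≤ h k ∧ h k ≤ 1) :
    ∃ q : Sym2 (Fin (2 * K + 1)) → unitInterval,
      VanishesOff q (sunEs K) ∧ (∀ m, m ≤ K → sunG K q m = g m) ∧ (∀ k, k < K → sunH K q k = h k) := by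
  have HS := isHairyCycle_sun hK
  set val : Sym2 (Fin (2 * K + 1)) → ℝ := fun e =>
    if hc : ∃ i, i < K + 1 ∧ e = cycE (K + 1) (sunCyc K) i then g (Classical.choose hc)
    else if hh' : ∃ k, k < K ∧ e = hairE (sunCyc K) sunBase (sunTip K) k then h (Classical.choose hh') else 0 with hval
  refine ⟨fun e => Set.projIcc 0 1 zero_le_one (val e), ?_, ?_, ?_⟩
  · intro e hd he
    have h1 : ¬ ∃ i, i < K + 1 ∧ e = cycE (K + 1) (sunCyc K) i := fun hex => he ((mem_Eset_sunEs_iff K e).2 (Or.inl hex))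
    have h2 : ¬ ∃ k, k < K ∧ e = hairE (sunCyc K) sunBase (sunTip K) k := fun hex => he ((mem_Eset_sunEs_iff K e).2 (Or.inr hex))
    have hv : val e = 0 := by simp only [hval, dif_neg h1, dif_neg h2]
    apply Subtype.ext
    show ((Set.projIcc (0 : ℝ) 1 zero_le_one (val e) : unitInterval) : ℝ) = ((0 : unitInterval) : ℝ)
    rw [hv, Set.projIcc_left]
    rfl
  · intro m hm
    have hex : ∃ i, i < K + 1 ∧ cycE (K + 1) (sunCyc K) m = cycE (K + 1) (sunCyc K) i := ⟨m, by omega, rfl⟩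
    have hi : Classical.choose hex = m :=
      (cycE_inj HS (Classical.choose_spec hex).1 (by omega) (Classical.choose_spec hex).2.symm)
    have hv : val (cycE (K + 1) (sunCyc K) m) = g m := by simp only [hval, dif_pos hex, hi]
    show ((Set.projIcc 0 1 zero_le_one (val (cycE (K + 1) (sunCyc K) m)) : ℝ)) = g m
    rw [hv, Set.projIcc_of_mem zero_le_one ⟨(hg m hm).1, (hg m hm).2⟩]
  · intro k hk
    have h1 : ¬ ∃ i, i < K + 1 ∧ hairE (sunCyc K) sunBase (sunTip K) k = cycE (K + 1) (sunCyc K) i :=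
      fun ⟨i, hi, heq⟩ => hairE_ne_cycE HS hk hi heq
    have hex : ∃ k', k' < K ∧ hairE (sunCyc K) sunBase (sunTip K) k = hairE (sunCyc K) sunBase (sunTip K) k' := ⟨k, hk, rfl⟩
    have hk' : Classical.choose hex = k :=
      (hairE_inj HS (Classical.choose_spec hex).1 hk (Classical.choose_spec hex).2.symm)
    have hv : val (hairE (sunCyc K) sunBase (sunTip K) k) = h k := by simp only [hval, dif_neg h1, dif_pos hex, hk']
    show ((Set.projIcc 0 1 zero_le_one (val (hairE (sunCyc K) sunBase (sunTip K) k)) : ℝ)) = h k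
    rw [hv, Set.projIcc_of_mem zero_le_one ⟨(hh k hk).1, (hh k hk).2⟩]

/-- `sunMarg` depends only on `g m`, `m ≤ K`, and `h k`. [this work] -/
theorem sunMarg_congr {g g' h h' : ℕ → ℝ} (hg : ∀ m, m ≤ K → g m = g' m) (hh : ∀ k, k < K → h k = h' k) {k : ℕ} (hk : k < K) :
    sunMarg K g h k = sunMarg K g' h' k := by
  have h1 : arcA g (k + 1) = arcA g' (k + 1) :=
    Finset.prod_congr rfl fun m hm => hg m (by rw [Finset.mem_range] at hm; omega)
  have h2 : arcB K g (k + 1) = arcB K g' (k + 1) :=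
    Finset.prod_congr rfl fun m hm => hg m (by rw [Finset.mem_Ico] at hm; omega)
  have h3 : arcA g (K + 1) = arcA g' (K + 1) :=
    Finset.prod_congr rfl fun m hm => hg m (by rw [Finset.mem_range] at hm; omega)
  unfold sunMarg
  rw [h1, h2, h3, hh k hk]

/-- `sunLaw` depends only on `g m`, `m ≤ K`, and `h k`, `k < K`. [this work] -/
theorem sunLaw_congr {g g' h h' : ℕ → ℝ} (hg : ∀ m, m ≤ K → g m = g' m) (hh : ∀ k, k < K → h k = h' k) (Φ : Finset ℕ → Prop) :
    sunLaw K g h Φ = sunLaw K g' h' Φ := by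
  unfold sunLaw
  refine Finset.sum_congr rfl fun Q _ => Finset.sum_congr rfl fun p _ => ?_
  have h1 : hairW K h Q = hairW K h' Q :=
    Finset.prod_congr rfl fun k hk => by rw [hh k (Finset.mem_range.1 hk)]
  have h2 : arcW K g p.1 p.2 = arcW K g' p.1 p.2 :=
    Finset.prod_congr rfl fun m hm => by
      rw [hg m (by have := (Finset.mem_filter.1 hm).1; rw [Finset.mem_range] at this; omega)]
  rw [h1, h2]

/-- **THE BRIDGE, converse (measure level ⟹ law level).**  If FAR at layer `j` holds on the sun graph for every weight function vanishing off it,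
then `SunFAR K j`. [this work] -/
theorem sunFAR_of_farp_sun (hK : 2 ≤ K) {j : ℕ}
    (hF : ∀ q : Sym2 (Fin (2 * K + 1)) → unitInterval, VanishesOff q (sunEs K) →
      FARp q ((range K).image (sunTip K)) (sunCyc K 0) j) :
    SunFAR K j := by
  intro g h hg hh hEN t hcut
  obtain ⟨q, hq, hqg, hqh⟩ := exists_sun_weight hK g h hg hh
  have hmarg : ∀ k, k < K → sunMarg K (sunG K q) (sunH K q) k = sunMarg K g h k := fun k hk => sunMarg_congr hqg hqh hk
  rw [← sunLaw_congr hqg hqh, ← real_sun_relayCount_le_eq hK q hq j]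
  refine hF q hq ?_ t ?_
  · rw [sum_real_sun_openConn_tip_eq hK q hq, Finset.sum_congr rfl fun k hk => hmarg k (Finset.mem_range.1 hk)]
    exact hEN
  · intro v hv
    obtain ⟨k, hk, rfl⟩ := Finset.mem_image.1 hv
    rw [probReal_compl_eq_one_sub MeasurableSet.of_discrete, real_sun_openConn_tip_eq hK q hq (Finset.mem_range.1 hk),
      hmarg k (Finset.mem_range.1 hk)]
    exact hcut k (Finset.mem_range.1 hk)

/-- **`SunFAR K j` ⟺ FAR at layer `j` on the sun graph for every weight function vanishing off it.** [this work] -/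
theorem sunFAR_iff_farp_sun (hK : 2 ≤ K) (j : ℕ) :
    SunFAR K j ↔ ∀ q : Sym2 (Fin (2 * K + 1)) → unitInterval, VanishesOff q (sunEs K) →
      FARp q ((range K).image (sunTip K)) (sunCyc K 0) j :=
  ⟨fun h q hq => farp_sun_of_sunFAR hK h q hq, sunFAR_of_farp_sun hK⟩

/-! ## Explicit forms of the arc weights (for law-level work) -/

/-- No closed cycle edge: `arcW K g (K+1) (K+1) = α_{K+1} = ∏_{m ≤ K} g m`. [this work] -/
theorem arcW_top (g : ℕ → ℝ) : arcW K g (K + 1) (K + 1) = arcA g (K + 1) := by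
  unfold arcW arcA
  rw [Finset.filter_true_of_mem fun m hm => by rw [Finset.mem_range] at hm; omega]
  exact Finset.prod_congr rfl fun m hm => by
    rw [Finset.mem_range] at hm
    rw [if_pos (Or.inl hm)]

/-- A closed extent `l ≤ l' ≤ K`: `arcW K g l l' = α_l · (1 − g l) · (1 − g l')^{[l < l']} · β_{l'+1}`. [this work] -/
theorem arcW_eq (g : ℕ → ℝ) {l l' : ℕ} (hll' : l ≤ l') (hl' : l' ≤ K) :
    arcW K g l l' = arcA g l * (1 - g l) * (if l < l' then 1 - g l' else 1) * arcB K g (l' + 1) := by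
  unfold arcW arcA arcB
  have hA : ∏ m ∈ range l, (if m < l ∨ l' < m then g m else 1 - g m) = ∏ m ∈ range l, g m :=
    Finset.prod_congr rfl fun m hm => by
      rw [Finset.mem_range] at hm
      rw [if_pos (Or.inl hm)]
  have hB : ∏ m ∈ Ico (l' + 1) (K + 1), (if m < l ∨ l' < m then g m else 1 - g m) = ∏ m ∈ Ico (l' + 1) (K + 1), g m :=
    Finset.prod_congr rfl fun m hm => by
      rw [Finset.mem_Ico] at hm
      rw [if_pos (Or.inr (by omega))]
  have hl : (if l < l ∨ l' < l then g l else 1 - g l) = 1 - g l := if_neg (by omega)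
  rcases Nat.eq_or_lt_of_le hll' with heq | hlt
  · subst heq
    have hS : (range (K + 1)).filter (fun m => ¬ (l < m ∧ m < l)) = (range l ∪ {l}) ∪ Ico (l + 1) (K + 1) := by
      ext m
      simp only [Finset.mem_filter, Finset.mem_range, Finset.mem_union, Finset.mem_singleton, Finset.mem_Ico]
      omega
    have hd1 : Disjoint (range l) {l} := Finset.disjoint_left.2 fun m h1 h2 => by
      rw [Finset.mem_range] at h1; rw [Finset.mem_singleton] at h2; omega
    have hd2 : Disjoint (range l ∪ {l}) (Ico (l + 1) (K + 1)) := Finset.disjoint_left.2 fun m h1 h2 => by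
      rw [Finset.mem_union, Finset.mem_range, Finset.mem_singleton] at h1; rw [Finset.mem_Ico] at h2; omega
    rw [hS, Finset.prod_union hd2, Finset.prod_union hd1, Finset.prod_singleton, hA, hB, hl, if_neg (lt_irrefl l), mul_one]
  · have hS : (range (K + 1)).filter (fun m => ¬ (l < m ∧ m < l')) = ((range l ∪ {l}) ∪ {l'}) ∪ Ico (l' + 1) (K + 1) := by
      ext m
      simp only [Finset.mem_filter, Finset.mem_range, Finset.mem_union, Finset.mem_singleton, Finset.mem_Ico]
      omega
    have hd1 : Disjoint (range l) {l} := Finset.disjoint_left.2 fun m h1 h2 => by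
      rw [Finset.mem_range] at h1; rw [Finset.mem_singleton] at h2; omega
    have hd2 : Disjoint (range l ∪ {l}) {l'} := Finset.disjoint_left.2 fun m h1 h2 => by
      rw [Finset.mem_union, Finset.mem_range, Finset.mem_singleton] at h1; rw [Finset.mem_singleton] at h2; omega
    have hd3 : Disjoint ((range l ∪ {l}) ∪ {l'}) (Ico (l' + 1) (K + 1)) := Finset.disjoint_left.2 fun m h1 h2 => by
      rw [Finset.mem_union, Finset.mem_union, Finset.mem_range, Finset.mem_singleton, Finset.mem_singleton] at h1
      rw [Finset.mem_Ico] at h2; omega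
    have hl'' : (if l' < l ∨ l' < l' then g l' else 1 - g l') = 1 - g l' := if_neg (by omega)
    rw [hS, Finset.prod_union hd3, Finset.prod_union hd2, Finset.prod_union hd1, Finset.prod_singleton, Finset.prod_singleton,
      hA, hB, hl, hl'', if_pos hlt]

/-- **The law-level functional split into "no closed edge" + closed extents**:
`sunLaw K g h Φ = Σ_Q hairW Q · (α_{K+1} 𝟙[Φ Q] + Σ_{l ≤ l' ≤ K} arcW l l' 𝟙[Φ(Q ∩ cov l l')])`. [this work] -/
theorem sunLaw_eq_top_add (g h : ℕ → ℝ) (Φ : Finset ℕ → Prop) :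
    sunLaw K g h Φ = ∑ Q ∈ (range K).powerset, hairW K h Q *
      (arcA g (K + 1) * (if Φ Q then 1 else 0) +
        ∑ p ∈ (arcIx K).filter (fun p => p.2 ≤ K), arcW K g p.1 p.2 * (if Φ (Q ∩ cov K p.1 p.2) then 1 else 0)) := by
  unfold sunLaw
  refine Finset.sum_congr rfl fun Q hQ => ?_
  rw [Finset.mem_powerset] at hQ
  have hsplit := (Finset.sum_filter_add_sum_filter_not (arcIx K) (fun p : ℕ × ℕ => p.2 ≤ K)
    (fun p => hairW K h Q * arcW K g p.1 p.2 * (if Φ (Q ∩ cov K p.1 p.2) then 1 else 0))).symm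
  rw [hsplit]
  have htop : (arcIx K).filter (fun p : ℕ × ℕ => ¬ p.2 ≤ K) = {(K + 1, K + 1)} := by
    ext p
    rw [Finset.mem_filter, mem_arcIx, Finset.mem_singleton]
    constructor
    · rintro ⟨h1 | h1, h2⟩
      · exact absurd h1.2 h2
      · exact Prod.ext h1.1 h1.2
    · intro hp; subst hp; simp
  have hcovQ : Q ∩ cov K (K + 1) (K + 1) = Q := by
    ext k
    rw [Finset.mem_inter, mem_cov]
    constructor
    · exact fun h => h.1
    · intro hk
      have := Finset.mem_range.1 (hQ hk)
      exact ⟨hk, this, Or.inl (by omega)⟩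
  rw [htop, Finset.sum_singleton, mul_add, Finset.mul_sum]
  dsimp only
  rw [arcW_top, hcovQ]
  simp only [mul_assoc]
  ring

end Summit.CriticalPhenomena.PercolationContinuityZ3.Theorems.HairyCycle

end
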